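import Mathlib
import HarnessLib
import Summits.QuantumFields.YangMills.Theses.FemtoCutoffLadder
import Summits.QuantumFields.YangMills.Theorems.FemtoCutoffLadderMatchedCouplingExists
import Summits.QuantumFields.YangMills.Theorems.FemtoCutoffLadderEventualSplitGlue
import Summits.QuantumFields.YangMills.Theorems.FemtoTransferGapBounds
import Summits.QuantumFields.YangMills.Theorems.FemtoTransferGapLevelsPos

/-!
# FemtoCutoffLadder — glue of the pointwise decomposition of `SubOctaveBounded`

`DyadicNestedUpper → EventualTowerDominancePw → SubOctaveBounded` (items stmt-QuantumFields-25766, -25890 ⟶ -24085), and the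
comparison `EventualTowerDominance → EventualTowerDominancePw` (the pointwise item is the WEAKER one: the height `k` is chosen after
the coarse coupling). Pure real arithmetic + `ε ↓ 0`; no summit is proved here.
-/

namespace Summit.QuantumFields.YangMills.Theorems.FemtoCutoffLadder

open Summit.QuantumFields.YangMills.Theorems.FemtoTransferGap
open Summit.QuantumFields.YangMills.Theses.FemtoCutoffLadder

/-- the filed form implies the pointwise form (so the new item is WEAKER). -/
theorem eventualTowerDominancePw_of_uniform : EventualTowerDominance → EventualTowerDominancePw := by
  rintro ⟨C, lam0, L0, hlam0, H⟩
  refine ⟨C, lam0, L0, hlam0, fun lam hlam hle L' _ L _ hL0 hL'L hL2 β' hW' ε hε => ?_⟩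
  obtain ⟨k, Hk⟩ := H lam hlam hle L' L hL0 hL'L hL2 ε hε
  exact ⟨k, fun M _ hM βM hWM hΛ => Hk M hM βM β' hWM hW' hΛ⟩

/-- glue (pointwise form): `DyadicNestedUpper → EventualTowerDominancePw → SubOctaveBounded`. -/
theorem eventualSplitGluePw_proof : DyadicNestedUpper → EventualTowerDominancePw → SubOctaveBounded := by
  intro hU hT
  obtain ⟨C₁, lamU, L0U, hlamU, HU⟩ := hU
  obtain ⟨C₂, lamT, L0T, hlamT, HT⟩ := hT
  have hM : MatchedCouplingExists := matchedCouplingExists_proof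
  refine ⟨C₁ + C₂, min (min lamU lamT) (1 / 2), max L0U L0T, lt_min (lt_min hlamU hlamT) (by norm_num), ?_⟩
  intro lam hlam hle L' _ L _ hL0 hL'L hL2 β β' hW hW' hΛ
  have hleU : lam ≤ lamU := hle.trans ((min_le_left _ _).trans (min_le_left _ _))
  have hleT : lam ≤ lamT := hle.trans ((min_le_left _ _).trans (min_le_right _ _))
  have hhalf : lam ≤ 1 / 2 := hle.trans (min_le_right _ _)
  have hL0U : L0U ≤ L := ((le_max_left _ _).trans hL0).trans hL'L
  have hL0T : L0T ≤ L' := (le_max_right _ _).trans hL0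
  apply le_exp_mul_of_forall_eps
  intro ε hε
  obtain ⟨k, HTk⟩ := HT lam hlam hleT L' L hL0T hL'L hL2 β' hW' ε hε
  haveI : NeZero (L * 2 ^ k) := ⟨mul_ne_zero (NeZero.ne L) (pow_ne_zero _ two_ne_zero)⟩
  obtain ⟨βM, hWM, hΛM⟩ := hM lam hlam hhalf L (L * 2 ^ k) β hW
  have h1 := HU lam hlam hleU k L (L * 2 ^ k) hL0U (Nat.mul_comm L (2 ^ k)) βM β hWM hW hΛM
  have h2 := HTk (L * 2 ^ k) rfl βM hWM (hΛM.trans hΛ)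
  set S := secondValue su2Rep L β ^ L
  set T := topValue su2Rep L β ^ L
  set S' := secondValue su2Rep L' β' ^ L'
  set T' := topValue su2Rep L' β' ^ L'
  set SM := secondValue su2Rep (L * 2 ^ k) βM ^ (L * 2 ^ k)
  set TM := topValue su2Rep (L * 2 ^ k) βM ^ (L * 2 ^ k)
  have hTM : 0 < TM := pow_pos (topValue_su2Rep_pos _ _) _
  have hT : 0 ≤ T := pow_nonneg (topValue_su2Rep_pos _ _).le _
  have hT' : 0 ≤ T' := pow_nonneg (topValue_su2Rep_pos _ _).le _
  rw [hΛM] at h1 h2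
  have key : S * T' * TM ≤ Real.exp ((C₁ + C₂) * luscherLambda β L ^ 2 + ε) * (S' * T) * TM := by
    have c1 : S * T' * TM ≤ Real.exp (C₁ * luscherLambda β L ^ 2) * (SM * T) * T' := by
      have := mul_le_mul_of_nonneg_right h1 hT'
      calc S * T' * TM = S * TM * T' := by ring
        _ ≤ _ := this
    have c2 : Real.exp (C₁ * luscherLambda β L ^ 2) * (SM * T) * T' ≤
        Real.exp (C₁ * luscherLambda β L ^ 2) * T * (Real.exp (C₂ * luscherLambda β L ^ 2 + ε) * (S' * TM)) := by
      have := mul_le_mul_of_nonneg_left h2 (mul_nonneg (Real.exp_pos (C₁ * luscherLambda β L ^ 2)).le hT)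
      calc Real.exp (C₁ * luscherLambda β L ^ 2) * (SM * T) * T'
          = Real.exp (C₁ * luscherLambda β L ^ 2) * T * (SM * T') := by ring
        _ ≤ _ := this
    calc S * T' * TM ≤ _ := c1
      _ ≤ _ := c2
      _ = Real.exp ((C₁ + C₂) * luscherLambda β L ^ 2 + ε) * (S' * T) * TM := by
          have : Real.exp ((C₁ + C₂) * luscherLambda β L ^ 2 + ε) =
              Real.exp (C₁ * luscherLambda β L ^ 2) * Real.exp (C₂ * luscherLambda β L ^ 2 + ε) := by
            rw [← Real.exp_add]; ring_nf
          rw [this]; ring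
  exact le_of_mul_le_mul_right key hTM

end Summit.QuantumFields.YangMills.Theorems.FemtoCutoffLadder
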